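import Summits.Ventures.PercRepro.K5ForestsAug1
import Summits.Ventures.PercRepro.K5ForestsAug2
import Summits.Ventures.PercRepro.K5ForestsAug3

/-!
# PercRepro — `M(K₅)`: the augmentation axiom assembled, the rank and the union-find rank (p9, gen 15; local draft)

On `K5ForestsBase` / `K5ForestsAug1–3`: the augmentation axiom `aug_forests` / `indepF_aug` from the three parts, the
rank `rk X` = the largest forest inside `X` (`rk_eq`: the largest circuit-free subset), and the union-find rank `rkG`
with its profile `profileG`; `K5MatroidRankA/B` prove `rkG = rk` on every edge set by the number of edges, and
`K5Matroid` builds the matroid and the profile table on them. Nothing here is about any window of S4.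
-/

namespace PercRepro.K5Ladder

open Finset

/-- The augmentation axiom over the forests (from the three parts). -/
theorem aug_forests : ∀ I ∈ forests, ∀ J ∈ forests, I.card < J.card →
    ∃ e ∈ J, e ∉ I ∧ indepF (insert e I) := by
  intro I hI J hJ
  have hJ' := (mem_forests_iff J).1 hJ
  have hI' := (mem_forests_iff I).1 hI
  simp only [forestsL, List.mem_append] at hI'
  rcases hI' with (h1 | h2) | h3
  · exact aug_forests_1 I h1 J hJ'
  · exact aug_forests_2 I h2 J hJ'
  · exact aug_forests_3 I h3 J hJ'

/-- The augmentation axiom for the forests of `K₅` (from `aug_forests` through `indepF_iff`). -/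
theorem indepF_aug : ∀ I J : Finset (Fin 10), indepF I → indepF J → I.card < J.card →
    ∃ e ∈ J, e ∉ I ∧ indepF (insert e I) := by
  intro I J hI hJ h
  rw [indepF_iff] at hI hJ
  exact aug_forests I hI J hJ h

/-- The rank of an edge set: the largest size of a forest inside it. -/
def rk (X : Finset (Fin 10)) : ℕ := (forests.filter (fun I => I ⊆ X)).sup Finset.card

/-- The profile of an edge set: `(rk X, rk Xᶜ)`. -/
def profile (X : Finset (Fin 10)) : ℕ × ℕ := (rk X, rk Xᶜ)

/-- The forests inside `X` are the independent subsets of `X`. -/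
theorem filter_forests_eq (X : Finset (Fin 10)) :
    forests.filter (fun I => I ⊆ X) = X.powerset.filter indepF := by
  ext I
  simp only [Finset.mem_filter, Finset.mem_powerset, indepF_iff]
  exact and_comm

/-- `rk X` is the largest size of an independent subset of `X`. -/
theorem rk_eq (X : Finset (Fin 10)) : rk X = (X.powerset.filter indepF).sup Finset.card := by
  rw [rk, filter_forests_eq]

/-- The endpoints of the edges of `K₅` (edge `i` joins `(ends i).1` and `(ends i).2`). -/
def ends : Fin 10 → Fin 5 × Fin 5 := ![(0, 1), (0, 2), (0, 3), (0, 4), (1, 2), (1, 3), (1, 4), (2, 3), (2, 4), (3, 4)]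

/-- The root of a vertex under a parent function with depth at most `4` (4 hops). -/
def root (par : Fin 5 → Fin 5) (v : Fin 5) : Fin 5 := par (par (par (par (par v))))

/-- One union-find step: an edge of `X` joining two different components merges them and raises the rank. -/
def ufStep (X : Finset (Fin 10)) (st : (Fin 5 → Fin 5) × ℕ) (e : Fin 10) : (Fin 5 → Fin 5) × ℕ :=
  if e ∈ X then
    if root st.1 (ends e).1 = root st.1 (ends e).2 then st
    else (Function.update st.1 (root st.1 (ends e).1) (root st.1 (ends e).2), st.2 + 1)
  else st

/-- The rank of an edge set by union-find over the edges in order (`5` vertices, `10` edges). -/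
def rkG (X : Finset (Fin 10)) : ℕ := ((List.finRange 10).foldl (ufStep X) (id, 0)).2

/-- The profile by union-find. -/
def profileG (X : Finset (Fin 10)) : ℕ × ℕ := (rkG X, rkG Xᶜ)

end PercRepro.K5Ladder
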